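import Literature.MathematicalPhysics.QuantumFieldTheory.Balaban1983to89.T3NontrivialityFromTilt
import HarnessLib

/-!
# `Balaban1983to89.T3NontrivialityFromTiltRefine` — (NT3) for the ORIGINAL family from the unit-scale tilt of a REFINED family
# (threshold removal for non-triviality: the companion of `T3UnitScaleTilt.continuumYM3Torus_of_refine_unitTiltTail`)

Cell `ym3-torus` (HUMAN RULING D-0037, YM ladder rung R3), seat `ym3-torus-p2` gen 15.  WHAT THIS IS NOT: not d = 4, not infinite volume,
not a mass gap, not Clay; `UnitTiltTail` (K1 ∧ K2) stays an OPEN hypothesis.  The route `UnitScaleTilt` meets its coupling thresholds by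
REFINEMENT (`F.refine n`, coupling `γL^{-n}`; [Balaban1985UV3] (3) p.256: the effective couplings decrease toward the ultraviolet) and
transfers EXISTENCE back to `(F, γ)` through `T3ThresholdRemoval.expectAt_refine`.  This file transfers NON-TRIVIALITY the same way:
the original family's plaquette string at step `K + n` is the refined family's unit-law integral of `coarseObs F n ℰp [∂p]` — the plaquette
variable of the `n`-FOLD AVERAGED refined unit field — and that observable is again ATOMLESS under every refined unit law, because Bałaban's
averaging pushes product Haar measure to an absolutely continuous measure at every level (tree `T3UnitLawDensityEML.haarAC_blockAvg`,
iterated in §1) and plaquette level sets are product-Haar-null (`T3NontrivialityFromTilt.fieldMeasure_plaqLevel_eq_zero`).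

* §1 `map_iter_blockAvg_absolutelyContinuous` — `(dU)_*(avg^k) ≪ dV_k` on the `n`-th approximation, `k ≤ n` (iterated HaarAC).
* §2 `fieldMeasure_plaquette3Level_eq_zero`, `refine_unitLaw_coarsePlaquetteLevel_eq_zero` — no atoms for `coarseObs F n ℰp [plaquette3 x μ ν]`.
* §3 **`exists_uniformVariance_plaquette_of_refine_unitTiltTail`**: `UnitTiltTail (F.refine n) ℰp (γL^{-n}) r w w'` with summable rates ⇒
  `∃ c, UniformVariance (F.scheme ℰp γ) (plaquette3 x μ ν) c`; and `continuumYM3Torus_nontrivial_of_refine_unitTiltTail`.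

References: T. Bałaban, Commun. Math. Phys. 102 (1985) 255–275 [Balaban1985UV3] ((1)–(3) p.256); CMP 109 (1987) 249–301 [Balaban1987RG1]
((0.4)/(0.11) p.253); C. King, CMP 102 (1986) 649–677 [King1986] (Thm 3.4 p.656); S. Chatterjee [Chatterjee2019YMProbabilists] (§6 p.19);
A. Jaffe, E. Witten [JaffeWittenClay2006] (§4 p.6, §6.5 p.11).
-/

noncomputable section

open MeasureTheory Filter Topology Set
open scoped ENNReal
open Literature.MathematicalPhysics.QuantumFieldTheory.Balaban1983to89.T3ContinuumYM3Torus
open Literature.MathematicalPhysics.QuantumFieldTheory.Balaban1983to89.T3ThresholdRemoval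
open Literature.MathematicalPhysics.QuantumFieldTheory.Balaban1983to89.T3LevelShift
open Literature.MathematicalPhysics.QuantumFieldTheory.Balaban1983to89.T3UnitScaleTilt
open Literature.MathematicalPhysics.QuantumFieldTheory.Balaban1983to89.T3UnitLawDensityEML (ℰp measurableE_ℰp haarAC_blockAvg)
open Literature.MathematicalPhysics.QuantumFieldTheory.Balaban1983to89.T3NontrivialityFromTilt
open Literature.MathematicalPhysics.QuantumFieldTheory.Balaban1983to89.T4Continuum
open Literature.MathematicalPhysics.QuantumFieldTheory.Balaban1983to89.T4CubeChartGnomonic (SU2)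

namespace Literature.MathematicalPhysics.QuantumFieldTheory.Balaban1983to89.T3NontrivialityFromTiltRefine

/-! ## §1 Iterated HaarAC: the `k`-fold block average of product Haar is absolutely continuous -/

section IterAC

variable (F : T3Family) (n : ℕ)

/-- **`(dU)_*(avg^k) ≪ dV_k` ON THE `n`-TH APPROXIMATION, `k ≤ n`**: Bałaban's (0.4) averaging with the printed small-loop average pushes
product Haar measure to an absolutely continuous measure at every level (`T3UnitLawDensityEML.haarAC_blockAvg`, i.e. the tree's
`BlockAveragingEMLHaarAC`), hence so does its `k`-fold iterate. [cite: Balaban1987RG1, (0.4)/(0.11) p.253] -/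
theorem map_iter_blockAvg_absolutelyContinuous :
    ∀ k : ℕ, k ≤ n →
      (fieldMeasure (F.P n) 0 SU2).map (Averaging.iter (fun j => BlockAveraging.blockAvg (P := F.P n) (j := j) ℰp) k) ≪
        fieldMeasure (F.P n) k SU2
  | 0, _ => by
    rw [show Averaging.iter (fun j => BlockAveraging.blockAvg (P := F.P n) (j := j) ℰp) 0 =
      (id : GaugeField (F.P n) 0 SU2 → GaugeField (F.P n) 0 SU2) from rfl, Measure.map_id]
  | k + 1, hk => by
    have hmeas : ∀ j, Measurable (BlockAveraging.blockAvg (P := F.P n) (j := j) ℰp).avg :=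
      fun j => F.avgMeasurable_of_measurableE ℰp measurableE_ℰp n j
    have ih := map_iter_blockAvg_absolutelyContinuous k (Nat.le_of_succ_le hk)
    rw [show Averaging.iter (fun j => BlockAveraging.blockAvg (P := F.P n) (j := j) ℰp) (k + 1) =
      (BlockAveraging.blockAvg (P := F.P n) (j := k) ℰp).avg ∘
        Averaging.iter (fun j => BlockAveraging.blockAvg (P := F.P n) (j := j) ℰp) k from rfl,
      ← Measure.map_map (hmeas k) (measurable_iter _ hmeas k)]
    exact (ih.map (hmeas k)).trans (haarAC_blockAvg F n (by omega))

/-- Hence the UNIT READING `unitShift ∘ avg^n` of the `n`-th approximation pushes product Haar on the finest lattice to a measure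
absolutely continuous w.r.t. product Haar on `T₁`. [cite: Balaban1987RG1, (0.4)/(0.11) p.253] -/
theorem map_unitShift_iter_absolutelyContinuous :
    (fieldMeasure (F.P n) 0 SU2).map (fun U => unitShift F n
        (Averaging.iter (fun j => BlockAveraging.blockAvg (P := F.P n) (j := j) ℰp) n U)) ≪ fieldMeasure (F.P 0) 0 SU2 := by
  have hmeas : ∀ j, Measurable (BlockAveraging.blockAvg (P := F.P n) (j := j) ℰp).avg :=
    fun j => F.avgMeasurable_of_measurableE ℰp measurableE_ℰp n j
  rw [show (fun U => unitShift F n (Averaging.iter (fun j => BlockAveraging.blockAvg (P := F.P n) (j := j) ℰp) n U)) =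
    (unitShift F n : GaugeField (F.P n) n SU2 → GaugeField (F.P 0) 0 SU2) ∘
      Averaging.iter (fun j => BlockAveraging.blockAvg (P := F.P n) (j := j) ℰp) n from rfl,
    ← Measure.map_map (measurable_unitShift F n) (measurable_iter _ hmeas n)]
  have h := (map_iter_blockAvg_absolutelyContinuous F n n le_rfl).map (measurable_unitShift (G := SU2) F n)
  rwa [(measurePreserving_unitShift (G := SU2) F n).map_eq] at h

end IterAC

/-! ## §2 No atoms for the coarse plaquette observable under the refined unit laws -/

section Atomless

variable (F : T3Family) (n : ℕ)

/-- The plaquette label's level sets on `T₁` are product-Haar-null (both orientations). [cite: Chatterjee2026YMHiggs, §3.2 (product Haar measure; Haar on SU(2) = uniform measure on S³)] -/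
theorem fieldMeasure_plaquette3Level_eq_zero (x : F.USite) {μ ν : Fin 3} (hμν : μ ≠ ν) (t : ℝ) :
    fieldMeasure (F.P 0) 0 SU2 {v | loopAt v ((plaquette3 x μ ν).1.atLevel 0) = t} = 0 := by
  rcases lt_or_gt_of_ne hμν with h | h
  · simp_rw [loopAt_plaquette3 x h]
    exact fieldMeasure_plaqLevel_eq_zero _ t
  · simp_rw [loopAt_plaquette3_rev x h]
    exact fieldMeasure_plaqLevel_eq_zero _ t

/-- The one-label coarse observable is the averaged loop variable (singleton product). [cite: Balaban1987RG1, (0.11) p.253] -/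
theorem coarseObs_singleton (C : ULoop3 F) (u : GaugeField ((F.refine n).P 0) 0 SU2) :
    coarseObs F n ℰp [C] u = F.avgObs ℰp n C (fieldShift (sitesPerDir_refine_unit F n) u) := by
  simp [coarseObs]

/-- The pair string's coarse observable is the square of the one-label one. [cite: Balaban1987RG1, (0.11) p.253] -/
theorem coarseObs_pair (C : ULoop3 F) (u : GaugeField ((F.refine n).P 0) 0 SU2) :
    coarseObs F n ℰp [C, C] u = coarseObs F n ℰp [C] u ^ 2 := by
  simp [coarseObs, pow_two]

/-- **NO ATOMS FOR THE COARSE PLAQUETTE OBSERVABLE**: under every unit law of the REFINED family (`γ' ≥ 0`, printed averaging, `SU(2)`),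
`coarseObs F n ℰp [plaquette3 x μ ν]` — the original family's unit-scale plaquette variable read on the refined unit field through `n`
more averaging steps — takes each value with probability `0` (unit law ≪ product Haar; `fieldShift`/`unitShift` preserve product Haar;
iterated HaarAC of §1; plaquette level sets null). [cite: Balaban1985UV3, (2) p.256 + (6) p.257] -/
theorem refine_unitLaw_coarsePlaquetteLevel_eq_zero {γ' : ℝ} (hγ' : 0 ≤ γ') (K : ℕ) (x : F.USite) {μ ν : Fin 3} (hμν : μ ≠ ν)
    (t : ℝ) :
    (F.refine n).unitLaw ℰp measurableE_ℰp γ' K {u | coarseObs F n ℰp [plaquette3 x μ ν] u = t} = 0 := by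
  rw [T3UnitLawDensityEML.unitLaw_eq_withDensity_emlDensity (F.refine n) K hγ']
  refine withDensity_absolutelyContinuous _ _ ?_
  have hmeas : ∀ j, Measurable (BlockAveraging.blockAvg (P := F.P n) (j := j) ℰp).avg :=
    fun j => F.avgMeasurable_of_measurableE ℰp measurableE_ℰp n j
  -- the set is the `fieldShift`-preimage of the `avgObs`-level set of the `n`-th approximation
  set N : Set (GaugeField (F.P 0) 0 SU2) := {v | loopAt v ((plaquette3 x μ ν).1.atLevel 0) = t} with hN_def
  have hN : MeasurableSet N := (measurable_loopAt _) (measurableSet_singleton t)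
  set Φ : GaugeField (F.P n) 0 SU2 → GaugeField (F.P 0) 0 SU2 := fun U => unitShift F n
    (Averaging.iter (fun j => BlockAveraging.blockAvg (P := F.P n) (j := j) ℰp) n U) with hΦ_def
  have hΦ : Measurable Φ := (measurable_unitShift F n).comp (measurable_iter _ hmeas n)
  have hset : {u : GaugeField ((F.refine n).P 0) 0 SU2 | coarseObs F n ℰp [plaquette3 x μ ν] u = t} =
      fieldShift (sitesPerDir_refine_unit F n) ⁻¹' (Φ ⁻¹' N) := by
    ext u
    rw [mem_setOf_eq, coarseObs_singleton, T3Family.avgObs_eq_loopAt_unitShift]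
    rfl
  -- `fieldShift` preserves product Haar (the refined unit lattice IS level `0` of `F.P n`; `P`/`PP` forms agree by `rfl`)
  have key := (measurePreserving_fieldShift (G := SU2) (sitesPerDir_refine_unit F n)).measure_preimage
    ((hΦ hN).nullMeasurableSet)
  rw [hset]
  refine key.trans ?_
  change fieldMeasure (F.P n) 0 SU2 (Φ ⁻¹' N) = 0
  rw [← Measure.map_apply hΦ hN]
  exact map_unitShift_iter_absolutelyContinuous F n (fieldMeasure_plaquette3Level_eq_zero F x hμν t)

end Atomless

/-! ## §3 (NT3) for the original family from the refined family's tilt -/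

section NT3

variable {r w w' : ℕ → ℝ}

/-- **(NT3) FOR `(F, γ)` FROM THE UNIT-SCALE TILT OF `(F.refine n, γL^{-n})`, NO SMALLNESS**: `UnitTiltTail (F.refine n) ℰp (γL^{-n}) r w w'`
with `r, w, w'` summable gives `UniformVariance (F.scheme ℰp γ) (plaquette3 x μ ν) c` for some `c > 0` (every base point, `μ ≠ ν`):
the core theorem `T3NontrivialityFromTilt.variance_eventually_ge_of_unitTiltTail` for the refined family and the atomless observable
`coarseObs F n ℰp [∂p]`, read back through `T3ThresholdRemoval.expectAt_refine`. [cite: Chatterjee2019YMProbabilists, §6 p.19] -/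
theorem exists_uniformVariance_plaquette_of_refine_unitTiltTail (F : T3Family) (n : ℕ) {γ : ℝ} (hγ : 0 ≤ γ)
    (h : UnitTiltTail (F.refine n) ℰp (γ * ((F.L : ℝ)⁻¹) ^ n) r w w') (hr : Summable r) (hw : Summable w) (hw' : Summable w')
    (x : F.USite) {μ ν : Fin 3} (hμν : μ ≠ ν) :
    ∃ c : ℝ, UniformVariance (F.scheme ℰp γ) (plaquette3 x μ ν) c := by
  have hγ' : 0 ≤ γ * ((F.L : ℝ)⁻¹) ^ n := mul_nonneg hγ (pow_nonneg (inv_nonneg.mpr (Nat.cast_nonneg _)) _)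
  obtain ⟨c, hc, hev⟩ := variance_eventually_ge_of_unitTiltTail (F := F.refine n) measurableE_ℰp hγ' h hr hw hw'
    (measurable_coarseObs F n ℰp measurableE_ℰp [plaquette3 x μ ν]) (abs_coarseObs_le_one F n ℰp [plaquette3 x μ ν])
    (fun K a => refine_unitLaw_coarsePlaquetteLevel_eq_zero F n hγ' K x hμν a)
  refine ⟨c, hc, ?_⟩
  obtain ⟨K₂, hK₂⟩ := eventually_atTop.1 hev
  refine eventually_atTop.2 ⟨K₂ + n, fun K' hK' => ?_⟩
  obtain ⟨d, rfl⟩ := Nat.exists_eq_add_of_le hK'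
  have hK : K₂ ≤ K₂ + d := Nat.le_add_right _ _
  rw [show K₂ + n + d = (K₂ + d) + n by ring, expectAt_refine F n ℰp measurableE_ℰp hγ, expectAt_refine F n ℰp measurableE_ℰp hγ]
  simp_rw [coarseObs_pair]
  exact hK₂ (K₂ + d) hK

/-- Hence **`ContinuumYM3Torus F ℰp γ ∧ LimitPointsNontrivial (F.scheme ℰp γ)` from the refined family's `UnitTiltTail` alone** (summable
rates): existence by `continuumYM3Torus_of_refine_unitTiltTail`, non-triviality by §3. [cite: JaffeWittenClay2006, §6.5 p.11] -/
theorem continuumYM3Torus_nontrivial_of_refine_unitTiltTail (F : T3Family) (n : ℕ) {γ : ℝ} (hγ : 0 ≤ γ)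
    (h : UnitTiltTail (F.refine n) ℰp (γ * ((F.L : ℝ)⁻¹) ^ n) r w w') (hr : Summable r) (hw : Summable w) (hw' : Summable w') :
    ContinuumYM3Torus F ℰp γ ∧ LimitPointsNontrivial (F.scheme ℰp γ) := by
  obtain ⟨c, hc⟩ := exists_uniformVariance_plaquette_of_refine_unitTiltTail F n hγ h hr hw hw' (0 : F.USite)
    (show (0 : Fin 3) ≠ 1 by decide)
  exact ⟨continuumYM3Torus_of_refine_unitTiltTail F ℰp measurableE_ℰp n hγ hr hw hw' h, limitPointsNontrivial_of_uniformVariance hc⟩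

end NT3

end Literature.MathematicalPhysics.QuantumFieldTheory.Balaban1983to89.T3NontrivialityFromTiltRefine

end
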